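import Mathlib
import Summits.Ventures.HodgeRepro.Tier4.Common.AdelicDefs
import Summits.Ventures.HodgeRepro.Tier4.Common.SettingOfData
import Summits.Ventures.HodgeRepro.Tier4.Line1.RTFSetting
import Summits.Ventures.HodgeRepro.Tier4.Line1.AdelicParts
import Summits.Ventures.HodgeRepro.Tier4.Line1.PlaneDefs
import Summits.Ventures.HodgeRepro.Tier4.Line4.RationalLineScalars
import Summits.Ventures.HodgeRepro.Tier4.Line4.OrbitFibre

/-!
# Tier4/Line4/TraceShift — the trace shift `Ω ↦ Ω − (t/2)·1` and the fibre bound on an abstract plane with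
`Ω² = t Ω − n` (C-L4-TRACE-WLOG, part 1 of 2)

Blind re-derivation cell `pub-hodge-repro`, Tier 4 «prove the step» (README §9–§10), seat t4-L1-p3 (gen 4).
Tree path `lean/Summits/Ventures/HodgeRepro/Tier4/Line4/TraceShift.lean`.

L2-p3's `E′`-scalar engine (`exists_torus_conj_of_scalar_nrm_eq`, `torusMatK`, `escK`, `nrmK d x y = x² + d y²`,
OrbitFibre / RationalLineScalars) is stated for `Ω² = −d`.  THE SHIFT removes the trace normalisation without touching
the engine: the trace-shifted plane `traceShift W c` (`Ω − c·1`, the SAME `B, P, Q`) with `c = t/2` has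
`Ω₀² = −(n − t²/4)` (`traceShift_Ω_sq`), `Ω₀ B = −B Ω₀ᵀ` from the hermitian relation `Ω B = B (t·1 − Ωᵀ)`
(`traceShift_Ω_mul_B`), and `−(n − t²/4)` is not a square when `t² − 4n` is not (`not_isSquare_shift`); the
engine's MATRIX-LEVEL theorem at `W₀` takes the block scalars in the shifted coordinates
(`escK_traceShift : escK W₀ (x + c y) y = escK W x y`, `nrmK (n − t²/4) (x + (t/2) y) y = x² + t x y + n y²`), and
the rational torus points are then built ON `W` ITSELF (`torusPtShift` via `GA.ofRationalMat W`: `torusMatK W₀ P u v`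
commutes with `W.Ω = Ω₀ + c·1` and is unitary for `W.B = W₀.B`), so the double cosets coincide in
`Setting.ofAdelicData W …` — no `W`-indexed object is transported.  `orbitOf_eq_of_scalar_normForm_eq`: on any plane
with `Ω² = t Ω − n`, `Ω B = B (t·1 − Ωᵀ)` and `t² − 4n` not a square, two regular rational points with the same
`(0,0)`-norm `x² + t x y + n y²` lie in one rational double coset.  Part 2 (OrbitInvariantFibreTrace) instantiates
this on the transported row plane.  No printed input.  HC_CM is NOT proved by anyone in this repository.
-/

namespace Summit.Ventures.HodgeRepro.Tier4.Line4

open Summit.Ventures.HodgeRepro.Tier4.Common Summit.Ventures.HodgeRepro.Tier4.Line1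
  Summit.Ventures.HodgeRepro.Tier4.Line1.RTF NumberField Matrix
open scoped NumberField

noncomputable section

/-! ## 1. The trace shift `Ω ↦ Ω − c·1` -/

section Shift

variable {k : Type} [Field k]

/-- **The trace-shifted plane**: the same `B`, `P`, `Q`, with `Ω` replaced by `Ω − c • 1`. -/
def traceShift (W : PlaneData k) (c : k) : PlaneData k where
  B := W.B
  Ω := W.Ω - c • (1 : Matrix (Fin 4) (Fin 4) k)
  P := W.P
  Q := W.Q
  B_symm := W.B_symm
  P_comm := fun i => by
    rw [Matrix.mul_sub, Matrix.sub_mul, W.P_comm i, Matrix.mul_smul, Matrix.smul_mul, Matrix.mul_one,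
      Matrix.one_mul]
  Q_comm := fun i => by
    rw [Matrix.mul_sub, Matrix.sub_mul, W.Q_comm i, Matrix.mul_smul, Matrix.smul_mul, Matrix.mul_one,
      Matrix.one_mul]
  P_idem := W.P_idem
  Q_idem := W.Q_idem
  P_sum := W.P_sum
  Q_sum := W.Q_sum

variable (W : PlaneData k) (c : k)

/-- The shifted plane has the same Gram matrix. -/
theorem traceShift_B : (traceShift W c).B = W.B := rfl

/-- The shifted plane has the same `P`-projectors. -/
theorem traceShift_P : (traceShift W c).P = W.P := rfl

/-- The shifted plane has the same `Q`-projectors. -/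
theorem traceShift_Q : (traceShift W c).Q = W.Q := rfl

/-- The shifted `Ω`. -/
theorem traceShift_Ω : (traceShift W c).Ω = W.Ω - c • (1 : Matrix (Fin 4) (Fin 4) k) := rfl


/-- A matrix commuting with `Ω` commutes with the shifted `Ω`. -/
theorem mul_traceShift_Ω_of_comm {M : Matrix (Fin 4) (Fin 4) k} (h : M * W.Ω = W.Ω * M) :
    M * (traceShift W c).Ω = (traceShift W c).Ω * M := by
  rw [traceShift_Ω, Matrix.mul_sub, Matrix.sub_mul, h, Matrix.mul_smul, Matrix.smul_mul, Matrix.mul_one,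
    Matrix.one_mul]

/-- A matrix commuting with the shifted `Ω` commutes with `Ω`. -/
theorem mul_Ω_of_mul_traceShift_Ω {M : Matrix (Fin 4) (Fin 4) k}
    (h : M * (traceShift W c).Ω = (traceShift W c).Ω * M) : M * W.Ω = W.Ω * M := by
  rw [traceShift_Ω, Matrix.mul_sub, Matrix.sub_mul, Matrix.mul_smul, Matrix.smul_mul, Matrix.mul_one,
    Matrix.one_mul] at h
  exact sub_left_injective h

/-- The rational `E′`-scalars in the shifted coordinates: `x + y Ω = (x + c y) + y Ω₀`. -/
theorem escK_traceShift (x y : k) : escK (traceShift W c) (x + c * y) y = escK W x y := by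
  simp only [escK, traceShift_Ω, smul_sub, add_smul, smul_smul, mul_comm y c]
  abel

/-- `Ω₀² = −(n − t²/4)` for `Ω₀ = Ω − (t/2)·1` when `Ω² = t Ω − n`. -/
theorem traceShift_Ω_sq [CharZero k] {t n : k}
    (hΩ : W.Ω * W.Ω = t • W.Ω - n • (1 : Matrix (Fin 4) (Fin 4) k)) :
    (traceShift W (t / 2)).Ω * (traceShift W (t / 2)).Ω =
      -((n - t ^ 2 / 4) • (1 : Matrix (Fin 4) (Fin 4) k)) := by
  rw [traceShift_Ω, Matrix.sub_mul, Matrix.mul_sub, Matrix.mul_sub, hΩ, Matrix.mul_smul, Matrix.smul_mul,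
    Matrix.mul_one, Matrix.one_mul, Matrix.smul_mul, Matrix.one_mul, smul_smul]
  ext i j
  simp only [Matrix.sub_apply, Matrix.smul_apply, Matrix.neg_apply, Matrix.one_apply, smul_eq_mul]
  split_ifs <;> ring

/-- `Ω₀ B = −B Ω₀ᵀ` for the shifted `Ω₀` when `Ω B = B (t·1 − Ωᵀ)` (the hermitian relation of the row plane). -/
theorem traceShift_Ω_mul_B [CharZero k] {t : k}
    (hΩB : W.Ω * W.B = W.B * (t • (1 : Matrix (Fin 4) (Fin 4) k) - W.Ωᵀ)) :
    (traceShift W (t / 2)).Ω * (traceShift W (t / 2)).B =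
      -((traceShift W (t / 2)).B * ((traceShift W (t / 2)).Ω)ᵀ) := by
  rw [traceShift_B, traceShift_Ω, Matrix.transpose_sub, Matrix.transpose_smul, Matrix.transpose_one,
    Matrix.sub_mul, hΩB, Matrix.mul_sub, Matrix.mul_sub, Matrix.mul_smul, Matrix.mul_smul, Matrix.mul_one,
    Matrix.smul_mul, Matrix.one_mul]
  have h2 : t • W.B = (t / 2) • W.B + (t / 2) • W.B := by rw [← add_smul, add_halves]
  rw [h2]
  abel

/-- `−(n − t²/4)` is not a square when `t² − 4n` is not. -/
theorem not_isSquare_shift [CharZero k] {t n : k} (hd : ¬ IsSquare (t ^ 2 - 4 * n)) :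
    ¬ IsSquare (-(n - t ^ 2 / 4)) := by
  rintro ⟨s, hs⟩
  apply hd
  exact ⟨2 * s, by linear_combination 4 * hs⟩

/-- `n ≠ 0` when `t² − 4n` is not a square. -/
theorem ne_zero_of_not_isSquare_discr {t n : k} (hd : ¬ IsSquare (t ^ 2 - 4 * n)) : n ≠ 0 := by
  rintro rfl
  exact hd ⟨t, by ring⟩

end Shift

/-! ## 2. Rational torus points on `W` from the shifted plane -/

section Points

variable {k : Type} [Field k] [NumberField k] (W : PlaneData k)

omit [NumberField k] in
/-- Projectors commuting with `Ω` commute with the shifted `Ω`. -/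
theorem P_comm_traceShift (c : k) (P : Fin 2 → Matrix (Fin 4) (Fin 4) k)
    (hPΩ : ∀ i, P i * W.Ω = W.Ω * P i) (i : Fin 2) :
    P i * (traceShift W c).Ω = (traceShift W c).Ω * P i :=
  mul_traceShift_Ω_of_comm W c (hPΩ i)

/-- **The rational torus point ON `W`** with the shifted plane's torus matrix `torusMatK W₀ P u v`
(`W₀ = traceShift W (t/2)`): it commutes with `W.Ω` and is unitary for `W.B = W₀.B`. -/
def torusPtShift {t n : k} (hΩ : W.Ω * W.Ω = t • W.Ω - n • (1 : Matrix (Fin 4) (Fin 4) k))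
    (hΩB : W.Ω * W.B = W.B * (t • (1 : Matrix (Fin 4) (Fin 4) k) - W.Ωᵀ))
    (P : Fin 2 → Matrix (Fin 4) (Fin 4) k) (hPΩ : ∀ i, P i * W.Ω = W.Ω * P i)
    (hPB : ∀ i, P i * W.B = W.B * (P i)ᵀ) (hPi : ∀ i, P i * P i = P i) (hPs : P 0 + P 1 = 1)
    (u v : Fin 2 → k) (hn : ∀ i, nrmK (n - t ^ 2 / 4) (u i) (v i) = 1) : GA W :=
  GA.ofRationalMat W (torusMatK (traceShift W (t / 2)) P u v)
    (torusMatK_det_ne_zero (traceShift W (t / 2)) (traceShift_Ω_sq W hΩ) P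
      (P_comm_traceShift W (t / 2) P hPΩ) hPi hPs u v hn)
    (mul_Ω_of_mul_traceShift_Ω W (t / 2)
      (torusMatK_mul_Omega (traceShift W (t / 2)) P (P_comm_traceShift W (t / 2) P hPΩ) u v))
    (torusMatK_mul_B_mul_transpose (traceShift W (t / 2)) (traceShift_Ω_sq W hΩ) (traceShift_Ω_mul_B W hΩB) P
      (P_comm_traceShift W (t / 2) P hPΩ) hPB hPi hPs u v hn)

/-- The matrix of the torus point. -/
theorem mat_torusPtShift {t n : k} (hΩ : W.Ω * W.Ω = t • W.Ω - n • (1 : Matrix (Fin 4) (Fin 4) k))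
    (hΩB : W.Ω * W.B = W.B * (t • (1 : Matrix (Fin 4) (Fin 4) k) - W.Ωᵀ))
    (P : Fin 2 → Matrix (Fin 4) (Fin 4) k) (hPΩ : ∀ i, P i * W.Ω = W.Ω * P i)
    (hPB : ∀ i, P i * W.B = W.B * (P i)ᵀ) (hPi : ∀ i, P i * P i = P i) (hPs : P 0 + P 1 = 1)
    (u v : Fin 2 → k) (hn : ∀ i, nrmK (n - t ^ 2 / 4) (u i) (v i) = 1) :
    GA.mat W (torusPtShift W hΩ hΩB P hPΩ hPB hPi hPs u v hn) =
      adMat k (torusMatK (traceShift W (t / 2)) P u v) := rfl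

/-- The torus point is a rational point. -/
theorem torusPtShift_mem_rationalPoints {t n : k} (hΩ : W.Ω * W.Ω = t • W.Ω - n • (1 : Matrix (Fin 4) (Fin 4) k))
    (hΩB : W.Ω * W.B = W.B * (t • (1 : Matrix (Fin 4) (Fin 4) k) - W.Ωᵀ))
    (P : Fin 2 → Matrix (Fin 4) (Fin 4) k) (hPΩ : ∀ i, P i * W.Ω = W.Ω * P i)
    (hPB : ∀ i, P i * W.B = W.B * (P i)ᵀ) (hPi : ∀ i, P i * P i = P i) (hPs : P 0 + P 1 = 1)
    (u v : Fin 2 → k) (hn : ∀ i, nrmK (n - t ^ 2 / 4) (u i) (v i) = 1) :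
    torusPtShift W hΩ hΩB P hPΩ hPB hPi hPs u v hn ∈ rationalPoints W :=
  GA.ofRationalMat_mem_rationalPoints W _ _ _ _

/-- The torus point commutes with each projector. -/
theorem torusPtShift_mem_commutant {t n : k} (hΩ : W.Ω * W.Ω = t • W.Ω - n • (1 : Matrix (Fin 4) (Fin 4) k))
    (hΩB : W.Ω * W.B = W.B * (t • (1 : Matrix (Fin 4) (Fin 4) k) - W.Ωᵀ))
    (P : Fin 2 → Matrix (Fin 4) (Fin 4) k) (hPΩ : ∀ i, P i * W.Ω = W.Ω * P i)
    (hPB : ∀ i, P i * W.B = W.B * (P i)ᵀ) (hPi : ∀ i, P i * P i = P i) (hPs : P 0 + P 1 = 1)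
    (u v : Fin 2 → k) (hn : ∀ i, nrmK (n - t ^ 2 / 4) (u i) (v i) = 1) (i : Fin 2) :
    torusPtShift W hΩ hΩB P hPΩ hPB hPi hPs u v hn ∈ commutant W (P i) := by
  change GA.mat W (torusPtShift W hΩ hΩB P hPΩ hPB hPi hPs u v hn) * adMat k (P i) =
    adMat k (P i) * GA.mat W (torusPtShift W hΩ hΩB P hPΩ hPB hPi hPs u v hn)
  rw [mat_torusPtShift, ← adMat_mul, ← adMat_mul,
    torusMatK_mul_P (traceShift W (t / 2)) P (P_comm_traceShift W (t / 2) P hPΩ) hPi hPs u v i]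

end Points

/-! ## 3. The fibre bound on `Setting.ofAdelicData W …` for a general trace -/

section Abstract

open MeasureTheory

variable {k : Type} [Field k] [NumberField k] (W : PlaneData k) [MeasurableSpace (GA W)] [BorelSpace (GA W)]
  (R : RTFData W) (μ : Measure (GA W)) [μ.IsHaarMeasure] [R.μT.IsHaarMeasure] [R.μT'.IsHaarMeasure]
  (DG : Set (GA W)) (fdG : IsFundamentalDomain (rationalPoints W) DG μ) (compG : IsCompact (closure DG))
  (compT : IsCompact (closure R.DT)) (compT' : IsCompact (closure R.DT'))

/-- **THE FIBRE BOUND, GENERAL TRACE**: on a plane with `Ω² = t Ω − n`, `Ω B = B (t·1 − Ωᵀ)` and `t² − 4n` not a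
square, two regular rational points with the same `(0,0)`-norm `x² + t x y + n y²` lie in one rational double coset
(L2-p3's `orbitOf_eq_of_scalar_nrm_eq` applied on the shifted plane `traceShift W (t/2)`, torus points built on `W`). -/
theorem orbitOf_eq_of_scalar_normForm_eq {t n : k}
    (hΩ : W.Ω * W.Ω = t • W.Ω - n • (1 : Matrix (Fin 4) (Fin 4) k)) (hd : ¬ IsSquare (t ^ 2 - 4 * n))
    (hΩB : W.Ω * W.B = W.B * (t • (1 : Matrix (Fin 4) (Fin 4) k) - W.Ωᵀ))
    (hPB : ∀ i, W.P i * W.B = W.B * (W.P i)ᵀ) (hQB : ∀ j, W.Q j * W.B = W.B * (W.Q j)ᵀ)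
    {w : Fin 2 → Fin 4 → k} (hw : ∀ i, w i ᵥ* W.P i = w i) (hw0 : ∀ i, w i ≠ 0)
    {v : Fin 2 → Fin 4 → k} (hv : ∀ j, v j ᵥ* W.Q j = v j)
    (ha0 : w 0 ᵥ* W.B ⬝ᵥ w 0 ≠ 0) (hb : ∀ j, v j ᵥ* W.B ⬝ᵥ v j ≠ 0)
    {γ γ' : (Setting.ofAdelicData W R μ DG fdG compG compT compT').Gk} {g g' : Matrix (Fin 4) (Fin 4) k}
    (hg : adMat k g = GA.mat W (γ : GA W)) (hg' : adMat k g' = GA.mat W (γ' : GA W))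
    {x y x' y' : Fin 2 → Fin 2 → k}
    (hxy : ∀ i j, (w i ᵥ* g) ᵥ* W.Q j = v j ᵥ* escK W (x i j) (y i j))
    (hxy' : ∀ i j, (w i ᵥ* g') ᵥ* W.Q j = v j ᵥ* escK W (x' i j) (y' i j))
    (hreg : ∀ i j, ¬ (x i j = 0 ∧ y i j = 0)) (hreg' : ∀ i j, ¬ (x' i j = 0 ∧ y' i j = 0))
    (h00 : x' 0 0 ^ 2 + t * x' 0 0 * y' 0 0 + n * y' 0 0 ^ 2 = x 0 0 ^ 2 + t * x 0 0 * y 0 0 + n * y 0 0 ^ 2) :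
    (Setting.ofAdelicData W R μ DG fdG compG compT compT').orbitOf γ =
      (Setting.ofAdelicData W R μ DG fdG compG compT compT').orbitOf γ' := by
  obtain ⟨hgΩ, hgB⟩ := rational_mat_props W hg
  obtain ⟨hg'Ω, hg'B⟩ := rational_mat_props W hg'
  have hΩ₀ : (traceShift W (t / 2)).Ω * (traceShift W (t / 2)).Ω =
      -((n - t ^ 2 / 4) • (1 : Matrix (Fin 4) (Fin 4) k)) := traceShift_Ω_sq W hΩ
  have hd₀ : ¬ IsSquare (-(n - t ^ 2 / 4)) := not_isSquare_shift hd
  have hΩB₀ : (traceShift W (t / 2)).Ω * (traceShift W (t / 2)).B =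
      -((traceShift W (t / 2)).B * ((traceShift W (t / 2)).Ω)ᵀ) := traceShift_Ω_mul_B W hΩB
  have hxy₀ : ∀ i j, (w i ᵥ* g) ᵥ* (traceShift W (t / 2)).Q j =
      v j ᵥ* escK (traceShift W (t / 2)) (x i j + t / 2 * y i j) (y i j) := by
    intro i j
    rw [escK_traceShift]
    exact hxy i j
  have hxy'₀ : ∀ i j, (w i ᵥ* g') ᵥ* (traceShift W (t / 2)).Q j =
      v j ᵥ* escK (traceShift W (t / 2)) (x' i j + t / 2 * y' i j) (y' i j) := by
    intro i j
    rw [escK_traceShift]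
    exact hxy' i j
  have hreg₀ : ∀ i j, ¬ (x i j + t / 2 * y i j = 0 ∧ y i j = 0) := by
    rintro i j ⟨h1, h2⟩
    apply hreg i j
    refine ⟨?_, h2⟩
    rwa [h2, mul_zero, add_zero] at h1
  have hreg'₀ : ∀ i j, ¬ (x' i j + t / 2 * y' i j = 0 ∧ y' i j = 0) := by
    rintro i j ⟨h1, h2⟩
    apply hreg' i j
    refine ⟨?_, h2⟩
    rwa [h2, mul_zero, add_zero] at h1
  have h00₀ : nrmK (n - t ^ 2 / 4) (x' 0 0 + t / 2 * y' 0 0) (y' 0 0) =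
      nrmK (n - t ^ 2 / 4) (x 0 0 + t / 2 * y 0 0) (y 0 0) := by
    simp only [nrmK]
    linear_combination h00
  obtain ⟨u, vv, u', vv', hun, hu'n, hconj⟩ := exists_torus_conj_of_scalar_nrm_eq (traceShift W (t / 2)) hΩ₀ hd₀
    hΩB₀ hPB hQB hw hw0 hv ha0 hb (mul_traceShift_Ω_of_comm W _ hgΩ) hgB (mul_traceShift_Ω_of_comm W _ hg'Ω) hg'B
    hxy₀ hxy'₀ hreg₀ hreg'₀ h00₀
  -- the rational torus points, on `W` itself
  set E : GA W := torusPtShift W hΩ hΩB W.P W.P_comm hPB W.P_idem W.P_sum u vv hun with hE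
  set E' : GA W := torusPtShift W hΩ hΩB W.Q W.Q_comm hQB W.Q_idem W.Q_sum u' vv' hu'n with hE'
  have hErat : E ∈ rationalPoints W := torusPtShift_mem_rationalPoints W hΩ hΩB W.P W.P_comm hPB W.P_idem W.P_sum u vv hun
  have hE'rat : E' ∈ rationalPoints W :=
    torusPtShift_mem_rationalPoints W hΩ hΩB W.Q W.Q_comm hQB W.Q_idem W.Q_sum u' vv' hu'n
  have hET : E ∈ torusT W := Subgroup.mem_inf.2
    ⟨torusPtShift_mem_commutant W hΩ hΩB W.P W.P_comm hPB W.P_idem W.P_sum u vv hun 0,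
      torusPtShift_mem_commutant W hΩ hΩB W.P W.P_comm hPB W.P_idem W.P_sum u vv hun 1⟩
  have hE'T : E' ∈ torusT' W := Subgroup.mem_inf.2
    ⟨torusPtShift_mem_commutant W hΩ hΩB W.Q W.Q_comm hQB W.Q_idem W.Q_sum u' vv' hu'n 0,
      torusPtShift_mem_commutant W hΩ hΩB W.Q W.Q_comm hQB W.Q_idem W.Q_sum u' vv' hu'n 1⟩
  -- `γ′ = E γ E′` in `G(𝔸)`
  have hGA : (γ' : GA W) = E * (γ : GA W) * E' := by
    apply Subtype.ext
    apply Units.ext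
    change GA.mat W (γ' : GA W) = GA.mat W (E * (γ : GA W) * E')
    rw [GA.mat_mul, GA.mat_mul, hE, hE', mat_torusPtShift, mat_torusPtShift, ← hg, ← hg', ← adMat_mul,
      ← adMat_mul, hconj]
    rfl
  -- the double cosets coincide
  unfold Setting.orbitOf
  rw [DoubleCoset.eq]
  refine ⟨⟨E, hErat⟩, Subgroup.mem_subgroupOf.2 hET, ⟨E', hE'rat⟩, Subgroup.mem_subgroupOf.2 hE'T, ?_⟩
  apply Subtype.ext
  exact hGA

end Abstract

end

end Summit.Ventures.HodgeRepro.Tier4.Line4
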